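import Summits.BirchSwinnertonDyer.Rank1Residual.Additive.BudgetFromRationalClasses
import Summits.BirchSwinnertonDyer.Rank1Residual.Additive.RationalClassesToLayerZero
import Summits.BirchSwinnertonDyer.Rank1Residual.Additive.UnramifiedClassesLocal
import Summits.BirchSwinnertonDyer.Rank1Residual.Additive.BudgetFromRelaxedKummerCount
import Summits.BirchSwinnertonDyer.Rank1Residual.X2.GreenbergVatsalUnramifiedAway
import HarnessLib

/-!
# The Route-G budget at level `0` from Tamagawa witnesses (T-E3g-BUD0, FILE 4b: assembly)

Cell `b2b-bsdres`, team n1011, seat p10 GEN 4.  This file assembles FILES 1, 2, 3b, 4a into the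
typed budget input of Route G,
`BudgetLeLambdaAt p W b` (`∀` cyclotomic `κ`, `∀` torsion Selmer-dual data `D` with `μ = 0`,
`b ≤ λ(X(E/ℚ_∞))`), with `b = #T₀` the number of finite places carrying a **Tamagawa witness**:
an unramified class of `H¹(ℚ_v, E[p])` that is not a local Kummer class (at a place `v ∤ p`).

The chain (Greenberg, LNM 1716 (1999), §5, pp. 114–118, made unconditional in the image of
`ρ̄_{E,p}` — no surjectivity / irreducibility is used):
* FILE 4a `exists_addSubgroup_relaxedKummer`: Poitou–Tate pair counting gives a finite subgroup
  `S = H¹_𝓖(ℚ, E[p])`, `#S ≥ p^{#T₀}`, of classes Kummer off `T₀` and at `∞`, and in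
  `H¹_ur + 𝓚_v` on `T₀`;
* FILE 3b `layerToInfty_resH1Hom_torsionToPrimaryH1_mem_localKerOver_of_mem_unramified_sup_kummer`:
  such classes satisfy the `ℚ_∞`-level local condition at `v ∈ T₀` (unramified classes die up the
  tower, `κ|_{D_v} ≠ 1` for the cyclotomic `κ`: `exists_apply_resGal_ne_one_of_isCyclotomic`);
* FILE 2 `exists_finset_torsion_selmerInftyPreimage_zero_card_eq`: they give `#S` classes of
  `A_0[p]`, `A_0 = h_0⁻¹(Sel_{p^∞}(E/ℚ_∞)^Γ)`, when `E(ℚ)[p] = 0`;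
* FILE 1 `budgetLeLambdaAt_of_prop414_of_layerClasses`: `h_0` is injective and
  `#Sel_{p^∞}(E/ℚ_∞)[p] = p^λ` (no finite `Λ`-submodule, Greenberg Prop. 4.14), so `λ ≥ #T₀`.

Hypotheses that are named facts of the tree: the Poitou–Tate family for Selmer structures
(`poitouTate_selmerStructure_duality ℚ`), the local Euler–Poincaré characteristic formula
(`localEulerPoincareCharacteristic ℚ_v`), Greenberg's Prop. 4.14
(`Greenberg1999.prop414_noFiniteSubmodule_of_not_dvd_torsionOrder`).  The Tamagawa witnesses
themselves (at split multiplicative `v` with `p ∣ ord_v(Δ)`: Greenberg p. 118) are the input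
`hwit`, to be produced place by place (FILE 5).
-/

set_option autoImplicit false

open scoped Classical
open Function Field NumberField IsDedekindDomain WeierstrassCurve
open Literature.NumberTheory.EllipticCurves Literature.NumberTheory.GaloisRepresentations
open Literature.NumberTheory.GaloisRepresentations.DiscreteGaloisModule (SelmerStructure unramifiedSubgroup)
open Literature.NumberTheory.GaloisCohomology

namespace Summit.BirchSwinnertonDyer.Rank1Residual.Additive

/-! ### §1 The cyclotomic `ℤ_p`-extension is non-trivial on every decomposition group `D_v`, `v ∤ p` -/

section Cyclotomic

variable {K : Type} [Field K] [NumberField K] {p : ℕ} [Fact p.Prime]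

/-- For the cyclotomic `ℤ_p`-extension `κ` of a number field `K` and a finite place `v ∤ p`, `κ`
is non-trivial on the decomposition group of `v`: some `σ ∈ Γ_{K_v}` has `κ(σ|_K) ≠ 1` (no finite
place splits completely in `K_∞/K`; tree: `not_decomp_le_kerSubgroup_of_isCyclotomic`, Frobenius has
infinite order under `χ_p`). [cite: Washington1997, §13.1] -/
theorem exists_apply_resGal_ne_one_of_isCyclotomic (κ : ZpExtension K p) (hκ : κ.IsCyclotomic)
    (v : HeightOneSpectrum (𝓞 K)) (hpv : ((p : ℕ) : 𝓞 K) ∉ v.asIdeal) :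
    ∃ σ : absoluteGaloisGroup (v.adicCompletion K), κ (resGal (K := K) (v.adicCompletion K) σ) ≠ 1 := by
  by_contra h
  refine X2.GreenbergVatsalUnramifiedAway.not_decomp_le_kerSubgroup_of_isCyclotomic κ v hκ hpv
    fun δ hδ ↦ ?_
  obtain ⟨σ, rfl⟩ := (GreenbergSelmer.mem_decomp_iff v δ).mp hδ
  exact ZpExtension.mem_kerSubgroup.mpr (not_not.mp ((not_exists.mp h) σ))

end Cyclotomic

/-! ### §2 Layer-`0` classes from Tamagawa witnesses (any number field) -/

section LayerZero

variable {K : Type} [Field K] [NumberField K] (W : WeierstrassCurve K) [W.IsElliptic] (p : ℕ)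
  [hp : Fact p.Prime]

/-- **`#T₀` Tamagawa witnesses give `p^{#T₀}` classes of `A_0[p]`** for every cyclotomic `κ`, when
`E(K)[p] = 0` and `p` is odd: FILE 4a's subgroup `S = H¹_𝓖(K, E[p])` (`#S ≥ p^{#T₀}`) maps
injectively into `A_0[p] = {z ∈ H¹(K, E[p^∞]) : h_0 z ∈ Sel_{p^∞}(E/K_∞)}[p]` by FILE 2, the local
condition over `K_∞` at `v ∈ T₀` being FILE 3b. [cite: GreenbergLNM1716, §5 pp. 114–118] -/
theorem exists_finset_layerZero_of_tamagawaWitnesses (hodd : p ≠ 2)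
    (hK : ∀ P : W.toAffine.Point, p • P = 0 → P = 0)
    (inv : LocalInvariants K p) (hperf : inv.IsPerfect) (hsum : inv.SumLocalTermEqZero)
    (hcompl : inv.SelmerComplement)
    (hEP : ∀ v : HeightOneSpectrum (𝓞 K), localEulerPoincareCharacteristic (v.adicCompletion K))
    (T₀ : Finset (HeightOneSpectrum (𝓞 K))) (hT₀p : ∀ v ∈ T₀, ((p : ℕ) : 𝓞 K) ∉ v.asIdeal)
    (hwit : ∀ v ∈ T₀, ∃ u ∈ unramifiedSubgroup
        ((W.torsionGaloisModule (p : ℤ)).restrictField (v.adicCompletion K)) 1,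
      u ∉ W.kummerLocalConditionAt (p : ℤ) (v.adicCompletion K))
    (κ : ZpExtension K p) (hκ : κ.IsCyclotomic) :
    ∃ s : Finset {z : W.selmerInftyPreimage κ 0 // p • z = 0}, p ^ T₀.card ≤ s.card := by
  obtain ⟨S, hSfin, hcard, hS⟩ :=
    exists_addSubgroup_relaxedKummer W p hodd inv hperf hsum hcompl hEP T₀ hwit
  haveI := hSfin
  obtain ⟨s, hs⟩ := exists_finset_torsion_selmerInftyPreimage_zero_card_eq W p κ hK S
    (↑T₀ : Set (HeightOneSpectrum (𝓞 K))) (fun y hy v hv ↦ (hS y hy).1 v hv)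
    (fun y hy w ↦ (hS y hy).2.1 w) fun y hy v hv ↦
      layerToInfty_resH1Hom_torsionToPrimaryH1_mem_localKerOver_of_mem_unramified_sup_kummer W p κ v
        (hT₀p v hv) (exists_apply_resGal_ne_one_of_isCyclotomic κ hκ v (hT₀p v hv)) y
        ((hS y hy).2.2 v hv)
  exact ⟨s, hs ▸ hcard⟩

end LayerZero

/-! ### §3 The budget over `ℚ` -/

section Budget

variable {W : WeierstrassCurve ℚ} [W.IsElliptic] [W.IsGloballyMinimal] {p : ℕ} [hp : Fact p.Prime]

/-- **T-E3g-BUD0: the Route-G budget at level `0`.** For an odd prime `p` with `p ∤ #E(ℚ)_tors`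
and a finite set `T₀` of primes `v ∤ p` each carrying a Tamagawa witness (an unramified
non-Kummer class in `H¹(ℚ_v, E[p])`), `BudgetLeLambdaAt p W #T₀` holds: `λ(X(E/ℚ_∞)) ≥ #T₀` for
every torsion Selmer-dual datum with `μ = 0` over the cyclotomic `ℤ_p`-extension — image-free
(surjective and reducible `ρ̄_{E,p}` alike).  Modulo the tree's named facts: Poitou–Tate duality for
Selmer structures, the local Euler–Poincaré formula, Greenberg's Prop. 4.14.
[cite: GreenbergLNM1716, §5 pp. 114–118 and Prop. 4.14] -/
theorem budgetLeLambdaAt_of_tamagawaWitnesses (hodd : p ≠ 2)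
    (h414 : Greenberg1999.prop414_noFiniteSubmodule_of_not_dvd_torsionOrder)
    (hPT : poitouTate_selmerStructure_duality ℚ)
    (hEP : ∀ v : HeightOneSpectrum (𝓞 ℚ), localEulerPoincareCharacteristic (v.adicCompletion ℚ))
    (htors : ¬ p ∣ W.torsionOrder)
    (T₀ : Finset (HeightOneSpectrum (𝓞 ℚ))) (hT₀p : ∀ v ∈ T₀, ((p : ℕ) : 𝓞 ℚ) ∉ v.asIdeal)
    (hwit : ∀ v ∈ T₀, ∃ u ∈ unramifiedSubgroup
        ((W.torsionGaloisModule (p : ℤ)).restrictField (v.adicCompletion ℚ)) 1,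
      u ∉ W.kummerLocalConditionAt (p : ℤ) (v.adicCompletion ℚ)) :
    BudgetLeLambdaAt p W T₀.card := by
  haveI : NeZero p := ⟨hp.out.ne_zero⟩
  obtain ⟨inv, hperf, hsum, -, hcompl⟩ := hPT p
  -- `E(ℚ)[p] = 0` (the `DecidableEq ℚ` instances of FILE 1 (`ℚ`) and FILE 2 (classical, any `K`)
  -- differ; `convert` identifies them)
  have hA : ∀ (κ : ZpExtension ℚ p), κ.IsCyclotomic →
      ∃ s : Finset {y : W.selmerInftyPreimage κ 0 // p • y = 0}, p ^ T₀.card ≤ s.card :=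
    fun κ hκ ↦ exists_finset_layerZero_of_tamagawaWitnesses W p hodd
      (fun P hP ↦ forall_smul_eq_zero_of_not_dvd_torsionOrder W p htors P (by convert hP))
      inv hperf hsum hcompl hEP T₀ hT₀p hwit κ hκ
  intro κ γ hκ hγ hT D _ hXt hμ
  exact budgetLeLambdaAt_of_prop414_of_layerClasses h414 htors 0 hA hκ hγ hT D hXt hμ

/-- **The residual count from Tamagawa witnesses**: under the same hypotheses and with
`Sel_{p^∞}(E/ℚ_∞)[p]` finite for the cyclotomic `κ`, `ResidualSelmerRankGeAt p W #T₀`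
(`#Sel_{p^∞}(E/ℚ_∞)[p] ≥ p^{#T₀}`), via FILE 1's `residualSelmerRankGeAt_of_layerClasses`.
[cite: GreenbergLNM1716, §5 pp. 114–118] -/
theorem residualSelmerRankGeAt_of_tamagawaWitnesses (hodd : p ≠ 2)
    (hPT : poitouTate_selmerStructure_duality ℚ)
    (hEP : ∀ v : HeightOneSpectrum (𝓞 ℚ), localEulerPoincareCharacteristic (v.adicCompletion ℚ))
    (htors : ¬ p ∣ W.torsionOrder)
    (hfin : ∀ (κ : ZpExtension ℚ p), κ.IsCyclotomic →
      Finite {s : W.selmerInfty κ // p • s = 0})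
    (T₀ : Finset (HeightOneSpectrum (𝓞 ℚ))) (hT₀p : ∀ v ∈ T₀, ((p : ℕ) : 𝓞 ℚ) ∉ v.asIdeal)
    (hwit : ∀ v ∈ T₀, ∃ u ∈ unramifiedSubgroup
        ((W.torsionGaloisModule (p : ℤ)).restrictField (v.adicCompletion ℚ)) 1,
      u ∉ W.kummerLocalConditionAt (p : ℤ) (v.adicCompletion ℚ)) :
    ResidualSelmerRankGeAt p W T₀.card := by
  haveI : NeZero p := ⟨hp.out.ne_zero⟩
  obtain ⟨inv, hperf, hsum, -, hcompl⟩ := hPT p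
  have hA : ∀ (κ : ZpExtension ℚ p), κ.IsCyclotomic →
      ∃ s : Finset {y : W.selmerInftyPreimage κ 0 // p • y = 0}, p ^ T₀.card ≤ s.card :=
    fun κ hκ ↦ exists_finset_layerZero_of_tamagawaWitnesses W p hodd
      (fun P hP ↦ forall_smul_eq_zero_of_not_dvd_torsionOrder W p htors P (by convert hP))
      inv hperf hsum hcompl hEP T₀ hT₀p hwit κ hκ
  intro κ hκ
  exact residualSelmerRankGeAt_of_layerClasses htors 0 hfin hA hκ

end Budget

end Summit.BirchSwinnertonDyer.Rank1Residual.Additive
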